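import Literature.Analysis.Complex.RiemannSphereDbar
import Literature.Analysis.Complex.RiemannSphereDbarKernel
import Literature.Analysis.Complex.RiemannSphereDbarRightInverse
import Mathlib.Analysis.Normed.Operator.Banach
import HarnessLib

/-!
# The tangential block: `(∂̄, three-point slice)` on vector fields of the Riemann sphere

Topic `Literature/Analysis/Complex`. Layer B5c of the analytic core of the local-foliation theorem
for embedded `J`-spheres (Wendl 2018, Thm. 2.46 and Prop. 2.53). In the two-chart description
`S² = ℂ_z ∪ ℂ_w` (`w = z⁻¹`) of `Literature/Analysis/Complex/RiemannSphereHolderSections.lean`,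
the vector fields on `S²` are the sections of the line bundle with clutching function
`τ w = -w²` (`ξ₁ w = -w² ξ₀ w⁻¹`, i.e. `T ℂℙ¹ = O(2)`), with Hölder spaces
`𝓣^{k,r} := holderSections F (fun w : ℂ => -w ^ 2) k r`, and the Cauchy–Riemann operator
`∂̄ = dbarSec : 𝓣^{k+1,r} → 𝓣'^{k,r} := holderSections F (dbarClutch fun w => -w ^ 2) k r`
(`Literature/Analysis/Complex/RiemannSphereDbar.lean`). Its kernel is the `3 dim F`-dimensional
space of quadratic vector fields `(a + z • b + z² • c) ∂_z` (the Möbius Lie algebra;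
`eq_quadratic_of_dbar_eq_zero_neg_sq`, `quadratic_mem_neg_sq` of
`Literature/Analysis/Complex/RiemannSphereDbarKernel.lean`), and it is onto (the Dolbeault right
inverse `exists_dbar_rightInverse_neg_sq` of
`Literature/Analysis/Complex/RiemannSphereDbarRightInverse.lean`). The **three-point slice**

  `slice₃ ξ = (ξ₀ 0, ξ₀ 1, ξ₁ 0) ∈ F³`  (the values at `z = 0`, `z = 1`, `z = ∞`)

is injective on the kernel, so the bordered operator

  `ξ ↦ (∂̄ ξ, slice₃ ξ) : 𝓣^{k+1,r} → 𝓣'^{k,r} × F³`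

is a linear bijection (`bijective_dbarSec_prod_slice₃`), hence a linear homeomorphism of Banach
spaces (`dbarSliceEquiv`, open mapping theorem). This is the `h₁` input (tangential block) of the
bordered block-triangular bookkeeping
`Literature.Analysis.Calculus.bijective_blockTriangular` in the implicit-function-theorem
construction of the deformation family of an embedded `J`-sphere (Wendl 2018, proof of Thm. 2.46:
the reparametrisation freedom `Aut(ℂℙ¹)` is killed by fixing three marked points).

* `RiemannSphere.sec₀_zero`, `sec₁_zero`, `dbarSec_eq_iff`, `dbarSec_eq_zero_iff`,
  `eq_of_sec₀_eq` — small bookkeeping facts for general clutching functions;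
* `RiemannSphere.slice₃`, `slice₃_apply` — the slice functional;
* `RiemannSphere.eq_zero_of_dbarSec_eq_zero_of_slice₃_eq_zero` — the slice kills the kernel;
* `RiemannSphere.bijective_dbarSec_prod_slice₃`, `bijective_smul_dbarSec_prod_slice₃`,
  `dbarSliceEquiv` — the theorem, its rescaled form `(c • ∂̄, slice₃)` (`c ≠ 0` real), and the
  `ContinuousLinearEquiv`.

Everything is proved; no named facts. `F` is a finite-dimensional complex Banach space (universe
`0`, as in the substrate), `0 < r < 1`.

## References

* C. Wendl, *Holomorphic Curves in Low Dimensions*, LNM 2216 (2018), §2.1.3, Thm. 2.46,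
  Prop. 2.53. [Wendl2018]
* D. McDuff, D. Salamon, *J-holomorphic curves and symplectic topology*, 2nd ed. (2012), App. C.
  [McDuffSalamon2012]
-/

noncomputable section

open Set Filter Metric Function
open scoped Topology NNReal ContDiff

namespace Literature.Analysis.Complex

namespace RiemannSphere

open Literature.Analysis.FunctionSpaces

variable {F : Type} [NormedAddCommGroup F] [NormedSpace ℂ F] {k : ℕ} {r : ℝ≥0}

/-! ### Representatives of the zero pair -/

/-- The `z`-representative of the zero pair of pieces vanishes. [folklore] -/
theorem sec₀_zero (τ : ℂ → ℂ) (z : ℂ) :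
    sec₀ τ (0 : ContDiffHolderFunction ℂ F k r × ContDiffHolderFunction ℂ F k r) z = 0 := by
  unfold sec₀
  split_ifs <;> simp

/-- The `w`-representative of the zero pair of pieces vanishes. [folklore] -/
theorem sec₁_zero (τ : ℂ → ℂ) (w : ℂ) :
    sec₁ τ (0 : ContDiffHolderFunction ℂ F k r × ContDiffHolderFunction ℂ F k r) w = 0 := by
  unfold sec₁
  split_ifs <;> simp

/-- The `z`-representative of the zero member of `𝓗^{k,r}_{τ'}` vanishes. [folklore] -/
theorem sec₀_coe_zero (τ τ' : ℂ → ℂ) (z : ℂ) :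
    sec₀ τ ((0 : holderSections F τ' k r) :
      ContDiffHolderFunction ℂ F k r × ContDiffHolderFunction ℂ F k r) z = 0 :=
  sec₀_zero τ z

/-- The `w`-representative of the zero member of `𝓗^{k,r}_{τ'}` vanishes. [folklore] -/
theorem sec₁_coe_zero (τ τ' : ℂ → ℂ) (w : ℂ) :
    sec₁ τ ((0 : holderSections F τ' k r) :
      ContDiffHolderFunction ℂ F k r × ContDiffHolderFunction ℂ F k r) w = 0 :=
  sec₁_zero τ w

/-! ### Members are determined by their `z`-representative -/

section General

variable {τ : ℂ → ℂ}

/-- **A member of `𝓗^{k,r}_τ` is determined by its `z`-representative** (`τ` zero-free and smooth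
off the origin): if `sec₀ τ p = sec₀ τ q` on all of `ℂ`, then `p = q`. Indeed the
`w`-representatives agree for `w ≠ 0` by the clutching relation, hence at `w = 0` by continuity,
and members with the same representatives are equal (`ext_of_sec₀_sec₁`). [folklore] -/
theorem eq_of_sec₀_eq {p q : holderSections F τ k r} (hτ : ∀ w, w ≠ 0 → τ w ≠ 0)
    (hτs : ContDiffOn ℝ ∞ τ {w | w ≠ 0})
    (h : ∀ z : ℂ, sec₀ τ (p : ContDiffHolderFunction ℂ F k r × ContDiffHolderFunction ℂ F k r) z =
      sec₀ τ (q : ContDiffHolderFunction ℂ F k r × ContDiffHolderFunction ℂ F k r) z) :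
    p = q := by
  have h₁ : sec₁ τ p.1 = sec₁ τ q.1 :=
    Continuous.ext_on (dense_compl_singleton (0 : ℂ)) (contDiff_sec₁ p.2 hτs).continuous
      (contDiff_sec₁ q.2 hτs).continuous fun w hw => by
        have hw : w ≠ 0 := hw
        rw [sec₁_eq_smul_sec₀ p.2 hτ hw, sec₁_eq_smul_sec₀ q.2 hτ hw, h]
  exact ext_of_sec₀_sec₁ hτ (fun z _ => h z) fun w _ => by rw [h₁]

/-- A member of `𝓗^{k,r}_τ` whose `z`-representative vanishes identically is zero. [folklore] -/
theorem eq_zero_of_forall_sec₀_eq_zero {p : holderSections F τ k r} (hτ : ∀ w, w ≠ 0 → τ w ≠ 0)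
    (hτs : ContDiffOn ℝ ∞ τ {w | w ≠ 0})
    (h : ∀ z : ℂ,
      sec₀ τ (p : ContDiffHolderFunction ℂ F k r × ContDiffHolderFunction ℂ F k r) z = 0) :
    p = 0 :=
  eq_of_sec₀_eq hτ hτs fun z => by rw [h z, sec₀_coe_zero]

/-! ### `∂̄ u = η` chart by chart -/

variable [CompleteSpace F] {hτ : ∀ w, w ≠ 0 → τ w ≠ 0} {hτh : DifferentiableOn ℂ τ {w | w ≠ 0}}
  {hr : r ≤ 1}

/-- **Chartwise characterisation of `∂̄ u = η`**: `dbarSec u = η` iff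
`∂̄ (sec₀ τ u) = sec₀ τ' η` and `∂̄ (sec₁ τ u) = sec₁ τ' η` on all of `ℂ` (`τ' = dbarClutch τ`;
the chart formulas `sec₀_dbarSec`, `sec₁_dbarSec` and extensionality by representatives).
[folklore] -/
theorem dbarSec_eq_iff (u : holderSections F τ (k + 1) r)
    (η : holderSections F (dbarClutch τ) k r) :
    dbarSec hτ hτh hr u = η ↔
      (∀ z : ℂ, dbarAlong 1 (sec₀ τ (u : ContDiffHolderFunction ℂ F (k + 1) r ×
          ContDiffHolderFunction ℂ F (k + 1) r)) z =
        sec₀ (dbarClutch τ) (η : ContDiffHolderFunction ℂ F k r ×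
          ContDiffHolderFunction ℂ F k r) z) ∧
      (∀ w : ℂ, dbarAlong 1 (sec₁ τ (u : ContDiffHolderFunction ℂ F (k + 1) r ×
          ContDiffHolderFunction ℂ F (k + 1) r)) w =
        sec₁ (dbarClutch τ) (η : ContDiffHolderFunction ℂ F k r ×
          ContDiffHolderFunction ℂ F k r) w) := by
  constructor
  · rintro rfl
    exact ⟨fun z => (sec₀_dbarSec u z).symm, fun w => (sec₁_dbarSec u w).symm⟩
  · rintro ⟨h₀, h₁⟩
    exact ext_of_sec₀_sec₁ (dbarClutch_ne_zero_of hτ) (fun z _ => by rw [sec₀_dbarSec, h₀])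
      fun w _ => by rw [sec₁_dbarSec, h₁]

/-- **Chartwise characterisation of `∂̄ u = 0`**: both representatives are `∂̄`-closed.
[folklore] -/
theorem dbarSec_eq_zero_iff (u : holderSections F τ (k + 1) r) :
    dbarSec hτ hτh hr u = 0 ↔
      (∀ z : ℂ, dbarAlong 1 (sec₀ τ (u : ContDiffHolderFunction ℂ F (k + 1) r ×
        ContDiffHolderFunction ℂ F (k + 1) r)) z = 0) ∧
      (∀ w : ℂ, dbarAlong 1 (sec₁ τ (u : ContDiffHolderFunction ℂ F (k + 1) r ×
        ContDiffHolderFunction ℂ F (k + 1) r)) w = 0) := by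
  rw [dbarSec_eq_iff]
  simp only [sec₀_coe_zero, sec₁_coe_zero]

end General

/-! ### The three-point slice -/

/-- **The three-point slice** `ξ ↦ (ξ₀ 0, ξ₀ 1, ξ₁ 0)` on Hölder vector fields of the Riemann
sphere: the values of the `z`-representative at `z = 0`, `z = 1` and of the `w`-representative at
`w = 0` (the point at infinity), a continuous linear map `𝓣^{k,r} →L[ℝ] F × F × F`. It is a
complement of the Möbius kernel of `∂̄` (three marked points kill `Aut(ℂℙ¹)`).
[cite: Wendl2018, Thm. 2.46] -/
def slice₃ (k : ℕ) (r : ℝ≥0) : holderSections F (fun w : ℂ => -w ^ 2) k r →L[ℝ] F × F × F :=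
  (eval₀CLM (fun w : ℂ => -w ^ 2) k r 0).prod
    ((eval₀CLM (fun w : ℂ => -w ^ 2) k r 1).prod (eval₁CLM (fun w : ℂ => -w ^ 2) k r 0))

/-- `slice₃ ξ = (sec₀ ξ 0, sec₀ ξ 1, sec₁ ξ 0)`. [cite: Wendl2018, Thm. 2.46] -/
theorem slice₃_apply (ξ : holderSections F (fun w : ℂ => -w ^ 2) k r) :
    slice₃ k r ξ =
      (sec₀ (fun w : ℂ => -w ^ 2)
          (ξ : ContDiffHolderFunction ℂ F k r × ContDiffHolderFunction ℂ F k r) 0,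
        sec₀ (fun w : ℂ => -w ^ 2)
          (ξ : ContDiffHolderFunction ℂ F k r × ContDiffHolderFunction ℂ F k r) 1,
        sec₁ (fun w : ℂ => -w ^ 2)
          (ξ : ContDiffHolderFunction ℂ F k r × ContDiffHolderFunction ℂ F k r) 0) := by
  have h0 : ‖(0 : ℂ)‖ < 2 := by simp
  have h1 : ‖(1 : ℂ)‖ < 2 := by simp
  refine Prod.ext (eval₀CLM_eq_sec₀ h0 ξ) (Prod.ext (eval₀CLM_eq_sec₀ h1 ξ) ?_)
  change eval₁CLM (fun w : ℂ => -w ^ 2) k r 0 ξ = sec₁ (fun w : ℂ => -w ^ 2) ξ.1 0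
  rw [eval₁CLM_apply, sec₁_of_norm_lt h0]

/-! ### The slice kills the kernel of `∂̄` -/

section Kernel

variable [CompleteSpace F]

/-- **The three-point slice is injective on the kernel of `∂̄`**: a Hölder vector field `ξ` with
`∂̄ ξ = 0` and `ξ₀ 0 = ξ₀ 1 = ξ₁ 0 = 0` vanishes. Indeed `ξ₀ z = a + z • b + z² • c`
(`eq_quadratic_of_dbar_eq_zero_neg_sq`), so `ξ` IS the quadratic member of `quadratic_mem_neg_sq`
(`eq_of_sec₀_eq`), whose slice is `(a, a + b + c, -c)`. [cite: Wendl2018, Thm. 2.46] -/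
theorem eq_zero_of_dbarSec_eq_zero_of_slice₃_eq_zero (hr : r ≤ 1)
    (ξ : holderSections F (fun w : ℂ => -w ^ 2) (k + 1) r)
    (hD : dbarSec neg_sq_clutch_ne_zero differentiableOn_neg_sq_clutch hr ξ = 0)
    (hS : slice₃ (k + 1) r ξ = 0) : ξ = 0 := by
  have hτs : ContDiffOn ℝ ∞ (fun w : ℂ => -w ^ 2) {w | w ≠ 0} :=
    contDiffOn_real_of_differentiableOn differentiableOn_neg_sq_clutch
  obtain ⟨h₀, h₁⟩ := (dbarSec_eq_zero_iff ξ).1 hD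
  obtain ⟨a, b, c, habc⟩ := eq_quadratic_of_dbar_eq_zero_neg_sq k ξ h₀ h₁
  obtain ⟨q, hq₀, hq₁, -, -⟩ := quadratic_mem_neg_sq (F := F) (r := r) (k + 1) hr a b c
  have hξq : ξ = q :=
    eq_of_sec₀_eq neg_sq_clutch_ne_zero hτs fun z => by rw [habc z, hq₀ z]
  subst hξq
  have hS' := hS
  rw [slice₃_apply, hq₀, hq₀, hq₁, Prod.mk_eq_zero, Prod.mk_eq_zero] at hS'
  simp only [zero_smul, add_zero, one_smul, one_pow, ne_eq, OfNat.ofNat_ne_zero,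
    not_false_eq_true, zero_pow, zero_add, neg_eq_zero] at hS'
  obtain ⟨ha, hab, hc⟩ := hS'
  have hb : b = 0 := by rwa [ha, hc, zero_add, add_zero] at hab
  refine eq_zero_of_forall_sec₀_eq_zero neg_sq_clutch_ne_zero hτs fun z => ?_
  rw [hq₀ z, ha, hb, hc, smul_zero, smul_zero, add_zero, add_zero]

end Kernel

/-! ### The theorem -/

section Main

variable [CompleteSpace F] [FiniteDimensional ℂ F]

/-- **The tangential block is an isomorphism**: on Hölder vector fields of the Riemann sphere
(`τ w = -w²`, `0 < r < 1`, `F` finite dimensional) the bordered Cauchy–Riemann operator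
`ξ ↦ (∂̄ ξ, (ξ₀ 0, ξ₀ 1, ξ₁ 0)) : 𝓣^{k+1,r} → 𝓣'^{k,r} × F³` is bijective. Injective: the kernel of
`∂̄` is the Möbius algebra of quadratic vector fields, killed by the three-point slice
(`eq_zero_of_dbarSec_eq_zero_of_slice₃_eq_zero`). Surjective: solve `∂̄ u = η` with the Dolbeault
right inverse (`exists_dbar_rightInverse_neg_sq`) and correct the slice by the quadratic vector
field with `a = λ₀ - u₀ 0`, `c = -(λ_∞ - u₁ 0)`, `b = λ₁ - u₀ 1 - a - c`.
[cite: Wendl2018, Thm. 2.46] -/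
theorem bijective_dbarSec_prod_slice₃ (k : ℕ) (hr0 : 0 < r) (hr1 : r < 1) :
    Function.Bijective fun ξ : holderSections F (fun w : ℂ => -w ^ 2) (k + 1) r =>
      (dbarSec neg_sq_clutch_ne_zero differentiableOn_neg_sq_clutch hr1.le ξ,
        slice₃ (k + 1) r ξ) := by
  constructor
  · -- injective: the difference is `∂̄`-closed with vanishing slice
    intro ξ₁ ξ₂ h
    simp only [Prod.mk.injEq] at h
    rw [← sub_eq_zero]
    refine eq_zero_of_dbarSec_eq_zero_of_slice₃_eq_zero hr1.le (ξ₁ - ξ₂) ?_ ?_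
    · rw [map_sub, h.1, sub_self]
    · rw [map_sub, h.2, sub_self]
  · -- surjective: right inverse, corrected by a quadratic vector field
    rintro ⟨η, l₀, l₁, l₂⟩
    obtain ⟨R, hR⟩ := exists_dbar_rightInverse_neg_sq (F := F) k hr0 hr1
    obtain ⟨hR₀, hR₁⟩ := hR η
    have hDu : dbarSec neg_sq_clutch_ne_zero differentiableOn_neg_sq_clutch hr1.le (R η) = η :=
      (dbarSec_eq_iff (R η) η).2 ⟨hR₀, hR₁⟩
    obtain ⟨q, hq₀, hq₁, hqd₀, hqd₁⟩ := quadratic_mem_neg_sq (F := F) (r := r) (k + 1) hr1.le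
      (l₀ - sec₀ (fun w : ℂ => -w ^ 2) (R η).1 0)
      (l₁ - sec₀ (fun w : ℂ => -w ^ 2) (R η).1 1 - (l₀ - sec₀ (fun w : ℂ => -w ^ 2) (R η).1 0)
        - -(l₂ - sec₁ (fun w : ℂ => -w ^ 2) (R η).1 0))
      (-(l₂ - sec₁ (fun w : ℂ => -w ^ 2) (R η).1 0))
    have hDq : dbarSec neg_sq_clutch_ne_zero differentiableOn_neg_sq_clutch hr1.le q = 0 :=
      (dbarSec_eq_zero_iff q).2 ⟨hqd₀, hqd₁⟩
    refine ⟨R η + q, ?_⟩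
    dsimp only
    rw [map_add, map_add, hDu, hDq, add_zero, slice₃_apply, slice₃_apply, hq₀, hq₀, hq₁]
    simp only [Prod.mk_add_mk, Prod.mk.injEq, true_and, zero_smul, add_zero, one_smul, one_pow,
      ne_eq, OfNat.ofNat_ne_zero, not_false_eq_true, zero_pow, zero_add]
    refine ⟨?_, ?_, ?_⟩ <;> abel

/-- **Rescaled form**: for a real constant `c ≠ 0` the bordered operator `ξ ↦ (c • ∂̄ ξ, slice₃ ξ)`
is bijective as well (the linearised `J`-sphere equation carries `2 ∂̄` on its diagonal).
[cite: Wendl2018, Thm. 2.46] -/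
theorem bijective_smul_dbarSec_prod_slice₃ (k : ℕ) (hr0 : 0 < r) (hr1 : r < 1) {c : ℝ}
    (hc : c ≠ 0) :
    Function.Bijective fun ξ : holderSections F (fun w : ℂ => -w ^ 2) (k + 1) r =>
      (c • dbarSec neg_sq_clutch_ne_zero differentiableOn_neg_sq_clutch hr1.le ξ,
        slice₃ (k + 1) r ξ) := by
  have he : Function.Bijective fun p :
      holderSections F (dbarClutch fun w : ℂ => -w ^ 2) k r × (F × F × F) => (c • p.1, p.2) := by
    refine ⟨fun p p' h => ?_, fun p => ⟨(c⁻¹ • p.1, p.2), ?_⟩⟩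
    · simp only [Prod.mk.injEq] at h
      refine Prod.ext ?_ h.2
      simpa only [inv_smul_smul₀ hc] using congrArg (fun x => c⁻¹ • x) h.1
    · simp only [smul_inv_smul₀ hc]
  exact he.comp (bijective_dbarSec_prod_slice₃ k hr0 hr1)

/-- **`(∂̄, slice₃)` as a linear homeomorphism `𝓣^{k+1,r} ≃L[ℝ] 𝓣'^{k,r} × F³`** (Banach open
mapping theorem; both sides are complete). [cite: Wendl2018, Thm. 2.46] -/
def dbarSliceEquiv (k : ℕ) (hr0 : 0 < r) (hr1 : r < 1) :
    holderSections F (fun w : ℂ => -w ^ 2) (k + 1) r ≃L[ℝ]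
      holderSections F (dbarClutch fun w : ℂ => -w ^ 2) k r × (F × F × F) :=
  ContinuousLinearEquiv.ofBijective
    ((dbarSec neg_sq_clutch_ne_zero differentiableOn_neg_sq_clutch hr1.le).prod (slice₃ (k + 1) r))
    (LinearMap.ker_eq_bot.2 (bijective_dbarSec_prod_slice₃ k hr0 hr1).1)
    (LinearMap.range_eq_top.2 (bijective_dbarSec_prod_slice₃ k hr0 hr1).2)

/-- `dbarSliceEquiv ξ = (∂̄ ξ, slice₃ ξ)`. [cite: Wendl2018, Thm. 2.46] -/
@[simp]
theorem dbarSliceEquiv_apply (k : ℕ) (hr0 : 0 < r) (hr1 : r < 1)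
    (ξ : holderSections F (fun w : ℂ => -w ^ 2) (k + 1) r) :
    dbarSliceEquiv k hr0 hr1 ξ =
      (dbarSec neg_sq_clutch_ne_zero differentiableOn_neg_sq_clutch hr1.le ξ, slice₃ (k + 1) r ξ) :=
  rfl

/-- **Unique solvability of the bordered problem**: for every `(0,1)`-form `η` with values in
`T S²` and every triple of values there is exactly one Hölder vector field `ξ` with `∂̄ ξ = η`,
`ξ₀ 0 = λ₀`, `ξ₀ 1 = λ₁`, `ξ₁ 0 = λ_∞`. [cite: Wendl2018, Thm. 2.46] -/
theorem existsUnique_dbarSec_eq_slice₃_eq (k : ℕ) (hr0 : 0 < r) (hr1 : r < 1)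
    (η : holderSections F (dbarClutch fun w : ℂ => -w ^ 2) k r) (l : F × F × F) :
    ∃! ξ : holderSections F (fun w : ℂ => -w ^ 2) (k + 1) r,
      dbarSec neg_sq_clutch_ne_zero differentiableOn_neg_sq_clutch hr1.le ξ = η ∧
        slice₃ (k + 1) r ξ = l := by
  obtain ⟨ξ, hξ⟩ := (bijective_dbarSec_prod_slice₃ (F := F) k hr0 hr1).2 (η, l)
  refine ⟨ξ, ⟨(Prod.mk.inj hξ).1, (Prod.mk.inj hξ).2⟩, fun ξ' hξ' => ?_⟩
  exact (bijective_dbarSec_prod_slice₃ (F := F) k hr0 hr1).1 ((Prod.ext hξ'.1 hξ'.2).trans hξ.symm)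

end Main

end RiemannSphere

end Literature.Analysis.Complex

end
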